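import Mathlib
import Summits.Ventures.Crystal3D.Theorems.StickyWulffConstantTextureLiminfTentCellKinds
import HarnessLib

/-!
# The tent certificate for fcc grains — cell volumes and vertex determination (eng g8)

Route `StickyWulffConstant` (`Summits/Ventures/Crystal3D`, cell `crystal3d-full`), support toward the crux
`TextureLiminf` (stmt-Ventures-19483), FREE half (tent certificate, TexShadow v6.1).  Consequences of the
barycentric coordinates of `…TentCellKinds.lean`:
* `closedChamber_labelUp/Dn/Corner_subset_rogersSimplex` and the VOLUME BOUNDS
  `volume (cellOf (labelUp p)) ≤ 1/(6√2)`, `… (labelDn p) ≤ 1/(6√2)` (`volume_tetDn`, the mirror of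
  `volume_tetUp`), `… (labelCorner p s) ≤ 1/(12√2)`;
* `affine_eq_zero_on_closedChamber_*` / `affine_eq_one_…` — an affine function vanishing (resp. equal to
  `1`) at the four vertices vanishes (resp. equals `1`) on the whole closed chamber;
* `dist_vertex_le_*` — every point of a closed chamber is within distance `√2` of each vertex of the cell
  (and of each vertex of the octahedron, for corners).
WHAT THIS IS NOT: the classification / the certificate; F-C1 not moved.
-/

noncomputable section

namespace Summit.Ventures.Crystal3D.TentCertificate

open Finset Summit.Ventures.Crystal3D MeasureTheory
open Literature.Geometry.DiscreteGeometry (intVec intVec_apply)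
open Literature.Barriers.AtomisticToContinuum (rogersSimplex edgeMap paramSimplex
  volume_rogersSimplex_eq_det det_edgeMap volume_paramSimplex)
open Literature.Analysis.Convexity (mem_rogersSimplex_iff)
open scoped RealInnerProductSpace

/-! ## Simplex containment and volume bounds -/

/-- `closedChamber (labelUp p) ⊆` the closed simplex `T⁺(p)`. -/
theorem closedChamber_labelUp_subset_rogersSimplex (p : Site) :
    closedChamber (labelUp p).1 (labelUp p).2 ⊆
      rogersSimplex (site p) (fun i : Fin 3 => site (p + tetUpV i.succ) - site p) := by
  intro x hx
  obtain ⟨t₀, t₁, t₂, h₀, h₁, h₂, hs, hx'⟩ := exists_barycentric_labelUp p hx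
  rw [mem_rogersSimplex_iff]
  exact ⟨t₀, t₁, t₂, h₀, h₁, h₂, hs, hx'⟩

/-- `closedChamber (labelDn p) ⊆` the closed simplex `T⁻(p)`. -/
theorem closedChamber_labelDn_subset_rogersSimplex (p : Site) :
    closedChamber (labelDn p).1 (labelDn p).2 ⊆
      rogersSimplex (site p) (fun i : Fin 3 => site (p + tetDnV i.succ) - site p) := by
  intro x hx
  obtain ⟨t₀, t₁, t₂, h₀, h₁, h₂, hs, hx'⟩ := exists_barycentric_labelDn p hx
  rw [mem_rogersSimplex_iff]
  exact ⟨t₀, t₁, t₂, h₀, h₁, h₂, hs, hx'⟩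

/-- `closedChamber (labelCorner p s) ⊆` the closed corner simplex. -/
theorem closedChamber_labelCorner_subset_rogersSimplex (p : Site) (s : Fin 3 → Bool) :
    closedChamber (labelCorner p s).1 (labelCorner p s).2 ⊆
      rogersSimplex (centre p) (fun a : Fin 3 => site (p + octV (octIdx a (s a))) - centre p) := by
  intro x hx
  obtain ⟨t₀, t₁, t₂, h₀, h₁, h₂, hs, hx'⟩ := exists_barycentric_labelCorner p s hx
  rw [mem_rogersSimplex_iff]
  exact ⟨t₀, t₁, t₂, h₀, h₁, h₂, hs, hx'⟩

/-- `|T⁻(p)| = 1/(6√2)` (mirror image of `volume_tetUp`). -/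
theorem volume_tetDn (p : Site) :
    volume (rogersSimplex (site p) (fun i : Fin 3 => site (p + tetDnV i.succ) - site p)) =
      ENNReal.ofReal (1 / (6 * Real.sqrt 2)) := by
  have hs : (0 : ℝ) < Real.sqrt 2 := by positivity
  have hs2 : Real.sqrt 2 * Real.sqrt 2 = 2 := Real.mul_self_sqrt (by norm_num)
  have hr0 : 0 < (Real.sqrt 2)⁻¹ := inv_pos.mpr hs
  have hr2 : (Real.sqrt 2)⁻¹ * (Real.sqrt 2)⁻¹ = 1 / 2 := by
    rw [← mul_inv, hs2]; norm_num
  have hR : (1 : ℝ) / (6 * Real.sqrt 2) = (Real.sqrt 2)⁻¹ / 6 := by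
    field_simp
  rw [hR, volume_rogersSimplex_eq_det, det_edgeMap, volume_paramSimplex,
    ← ENNReal.ofReal_mul (abs_nonneg _)]
  congr 1
  have hc : ∀ i : Fin 3, site (p + tetDnV i.succ) - site p = site (tetDnV i.succ) := by
    intro i; rw [site_add]; abel
  simp only [hc]
  rw [Matrix.det_fin_three]
  simp [site, tetDnV, fccPoint, intVec_apply, Matrix.of_apply]
  generalize (Real.sqrt 2)⁻¹ = r at hr0 hr2 ⊢
  have h3 : r * r * r = r / 2 := by
    rw [show r * r * r = (r * r) * r by ring, hr2]; ring
  rw [show r * r * r + r * r * r = r by rw [h3]; ring, abs_of_pos hr0]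
  ring

/-- **Volume bound for an up-tetrahedron chamber**: `|cellOf (labelUp p)| ≤ 1/(6√2)`. -/
theorem volume_cellOf_labelUp_le (p : Site) :
    volume (cellOf (labelUp p).1 (labelUp p).2) ≤ ENNReal.ofReal (1 / (6 * Real.sqrt 2)) := by
  rw [← volume_tetUp p]
  exact measure_mono ((cellOf_subset_closedChamber _ _).trans
    (closedChamber_labelUp_subset_rogersSimplex p))

/-- **Volume bound for a down-tetrahedron chamber**: `|cellOf (labelDn p)| ≤ 1/(6√2)`. -/
theorem volume_cellOf_labelDn_le (p : Site) :
    volume (cellOf (labelDn p).1 (labelDn p).2) ≤ ENNReal.ofReal (1 / (6 * Real.sqrt 2)) := by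
  rw [← volume_tetDn p]
  exact measure_mono ((cellOf_subset_closedChamber _ _).trans
    (closedChamber_labelDn_subset_rogersSimplex p))

/-- **Volume bound for a corner chamber**: `|cellOf (labelCorner p s)| ≤ 1/(12√2)`. -/
theorem volume_cellOf_labelCorner_le (p : Site) (s : Fin 3 → Bool) :
    volume (cellOf (labelCorner p s).1 (labelCorner p s).2) ≤ ENNReal.ofReal (1 / (12 * Real.sqrt 2)) := by
  rw [← volume_corner p s]
  exact measure_mono ((cellOf_subset_closedChamber _ _).trans
    (closedChamber_labelCorner_subset_rogersSimplex p s))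

/-! ## An affine function on a cell is determined by its values at the vertices -/

/-- Up-tetrahedron: the value of an affine function on the closed chamber is the barycentric combination
of its vertex values. -/
theorem affine_eq_combo_labelUp (p : Site) (g : EuclideanSpace ℝ (Fin 3)) (b : ℝ)
    {x : EuclideanSpace ℝ (Fin 3)} (hx : x ∈ closedChamber (labelUp p).1 (labelUp p).2) :
    ∃ t₀ t₁ t₂ : ℝ, 0 ≤ t₀ ∧ 0 ≤ t₁ ∧ 0 ≤ t₂ ∧ t₀ + t₁ + t₂ ≤ 1 ∧
      ⟪g, x⟫ + b = (1 - t₀ - t₁ - t₂) * (⟪g, site (p + tetUpV 0)⟫ + b) +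
        t₀ * (⟪g, site (p + tetUpV 1)⟫ + b) + t₁ * (⟪g, site (p + tetUpV 2)⟫ + b) +
        t₂ * (⟪g, site (p + tetUpV 3)⟫ + b) := by
  obtain ⟨t₀, t₁, t₂, h₀, h₁, h₂, hs, hx'⟩ := exists_barycentric_labelUp p hx
  refine ⟨t₀, t₁, t₂, h₀, h₁, h₂, hs, ?_⟩
  have h0 : site (p + tetUpV 0) = site p := by
    have : p + tetUpV 0 = p := by funext i; fin_cases i <;> simp [tetUpV]
    rw [this]
  rw [hx', affine_barycentric, h0]

/-- Down-tetrahedron: barycentric combination of vertex values. -/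
theorem affine_eq_combo_labelDn (p : Site) (g : EuclideanSpace ℝ (Fin 3)) (b : ℝ)
    {x : EuclideanSpace ℝ (Fin 3)} (hx : x ∈ closedChamber (labelDn p).1 (labelDn p).2) :
    ∃ t₀ t₁ t₂ : ℝ, 0 ≤ t₀ ∧ 0 ≤ t₁ ∧ 0 ≤ t₂ ∧ t₀ + t₁ + t₂ ≤ 1 ∧
      ⟪g, x⟫ + b = (1 - t₀ - t₁ - t₂) * (⟪g, site (p + tetDnV 0)⟫ + b) +
        t₀ * (⟪g, site (p + tetDnV 1)⟫ + b) + t₁ * (⟪g, site (p + tetDnV 2)⟫ + b) +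
        t₂ * (⟪g, site (p + tetDnV 3)⟫ + b) := by
  obtain ⟨t₀, t₁, t₂, h₀, h₁, h₂, hs, hx'⟩ := exists_barycentric_labelDn p hx
  refine ⟨t₀, t₁, t₂, h₀, h₁, h₂, hs, ?_⟩
  have h0 : site (p + tetDnV 0) = site p := by
    have : p + tetDnV 0 = p := by funext i; fin_cases i <;> simp [tetDnV]
    rw [this]
  rw [hx', affine_barycentric, h0]

/-- Corner: barycentric combination of vertex values (apex `centre p` and the three chosen octahedron
vertices). -/
theorem affine_eq_combo_labelCorner (p : Site) (s : Fin 3 → Bool) (g : EuclideanSpace ℝ (Fin 3)) (b : ℝ)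
    {x : EuclideanSpace ℝ (Fin 3)} (hx : x ∈ closedChamber (labelCorner p s).1 (labelCorner p s).2) :
    ∃ t₀ t₁ t₂ : ℝ, 0 ≤ t₀ ∧ 0 ≤ t₁ ∧ 0 ≤ t₂ ∧ t₀ + t₁ + t₂ ≤ 1 ∧
      ⟪g, x⟫ + b = (1 - t₀ - t₁ - t₂) * (⟪g, centre p⟫ + b) +
        t₀ * (⟪g, site (p + octV (octIdx 0 (s 0)))⟫ + b) +
        t₁ * (⟪g, site (p + octV (octIdx 1 (s 1)))⟫ + b) +
        t₂ * (⟪g, site (p + octV (octIdx 2 (s 2)))⟫ + b) := by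
  obtain ⟨t₀, t₁, t₂, h₀, h₁, h₂, hs, hx'⟩ := exists_barycentric_labelCorner p s hx
  refine ⟨t₀, t₁, t₂, h₀, h₁, h₂, hs, ?_⟩
  rw [hx', affine_barycentric]

end Summit.Ventures.Crystal3D.TentCertificate

end
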